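import Summits.BirchSwinnertonDyer.BirchSwinnertonDyer.Theorems.EisensteinPrimesGoodLatticeBDPValueH1OfCGLS
import Summits.BirchSwinnertonDyer.BirchSwinnertonDyer.Theorems.EisensteinPrimesGoodLatticeBDPValueOfNamedFacts
import HarnessLib
/-!
# Crux 2 `GoodLatticeBDPValue` (stmt-BirchSwinnertonDyer-19032) MODULO ITS NAMED FACTS — the composition with stub 1 cut to SIX
# published conjuncts (Castella–Hsieh 2018 dropped)

Cell `bsd-eis`, width seat `bsd-line-x1-p1-w5` (gen 2); helper `--supports stmt-BirchSwinnertonDyer-19032`.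

LEAD g5's `GoodLatticeBDPValueOfNamedFacts.goodLatticeBDPValue_of_namedFacts` (p660812) is the registered skeleton halves v22
(`Cruxes/GoodLatticeBDPValue/Lines/halves.lean`, sha256 873a80a3…) with its five stubs as HYPOTHESES:
`⟨stub 1: 7 PUB⟩ → ⟨3a-A⟩ → ⟨stub 4: 8 PUB⟩ → ⟨stub 4b: 4 PUB⟩ → ⟨CD2⟩ → Theses.EisensteinPrimes.GoodLatticeBDPValue`.
This file is the SAME composition with stub 1 replaced by `stub_publishedFacts₆` = its conjuncts 2–7 (Carayol, CGLS proof of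
Thm. 4.2.2 first half, CGLS Thm. 5.1.3, Bleher et al. Thm. 3.3.1, de Shalit II.6.4 (i), Hida Thm. I) — the first conjunct
`castellaHsieh2018_exists_isBDPLFunction` is not needed: its one use (H1, the BDP frame exists) is discharged from conjunct 3 by
`GoodLatticeBDPValueH1OfCGLS.goodBDPExistsOnTree_of_cgls` (p661754), and the terminal consumer without `hCH` is
`GoodLatticeBDPValueH1OfCGLS.goodLatticeBDPValue_of_pub_of_leTD_of_le_of_anQ_of_cgls`. The other four hypotheses are the
registered stub statements BYTE FOR BYTE (explicit binders).

* §1 `anQ_of_thm222_OPEN` — [AN]-DS-Free in the ℚ-currency from THREE named inputs: KY Thm. 2.2.2 at every odd `p`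
  (`thm222_anacong_goodLattice_OPEN`, however obtained — on the line: `thm222_OPEN_of_slices` / LEAD #8 from the `5 ≤ p` slice and
  3a-A), de Shalit's functional equation (AN-F₁ `GoodLatticeBDPValueAnQStubs.stub_katzLineIntFrameQ`) and CGLS Thm. 2.1.2 (AN-F₂
  `KatzLineDescent.stub_katzLineDescentQ`) — LEAD g5's `anQ_of_pieces` with its inputs made explicit (no 7-tuple).
* §2 `goodLatticeBDPValue_of_namedFacts₆ : ⟨stub 1′: 6 PUB⟩ → ⟨3a-A⟩ → ⟨stub 4: 8 PUB⟩ → ⟨stub 4b: 4 PUB⟩ → ⟨CD2⟩ →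
  Summit.….Theses.EisensteinPrimes.GoodLatticeBDPValue` — crux 2 BY NAME modulo 19 PUBLISHED named facts + the PUB-composed
  candidate 3a-A (a RESHAPE OPTION for the next LEAD: `stub_publishedFacts` 7 → 6; nothing is registered by this seat).

Remark (width seat w6 g2's reading on LEAD #8 `GoodLatticeBDPValueAnThreeBookkeeping.thm222_OPEN_of_fullDescentDatum_of_five_le`):
the component `thm222_anacong_goodLattice_of_ne_one` of stub 4b is likewise unused once 3a-A is granted; the registered
4-conjunct shape is kept here. HONEST FRAMING: CONDITIONAL theorems (hypotheses = published results as `Prop`s + 3a-A); no named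
fact is discharged, no summit statement / BSD / IMC / Keller–Yin theorem is proved; 0 sorry.
[cite: KellerYin2024, Thm. 2.2.2, Thm. 3.0.8] [cite: CastellaGrossiLeeSkinner2022, proof of Thm. 4.2.2, Thm. 2.1.1, Thm. 2.1.2, Thm. 2.2.2 with (2.16), Thm. 5.1.3]
[cite: deShalit1987, II.6.4 Theorem (i)] [cite: Kriz2016, Thm. 34, Thm. 35, Rem. 33]
-/


set_option linter.dupNamespace false
set_option autoImplicit false
open scoped Classical

open PowerSeries WeierstrassCurve NumberField IsDedekindDomain Field
  Literature.NumberTheory.GaloisRepresentations Literature.NumberTheory.EllipticCurves.GreenbergVatsal2000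
  Summit.BirchSwinnertonDyer.BirchSwinnertonDyer.Theorems.EisensteinPrimesMuLambda
  Literature.NumberTheory.EllipticCurves Literature.NumberTheory.EllipticCurves.ModularForms
  Literature.NumberTheory.EllipticCurves.Rank1Residual Literature.NumberTheory.EllipticCurves.Castella2018
  Literature.NumberTheory.EllipticCurves.GreenbergSelmer Literature.NumberTheory.QuadraticFields
  Literature.NumberTheory.EllipticCurves.CastellaGrossiLeeSkinner2022
  Literature.NumberTheory.EllipticCurves.KellerYin2024 Literature.NumberTheory.EllipticCurves.IwasawaAlgebra
  Literature.NumberTheory.EllipticCurves.Rubin1991 Literature.NumberTheory.EllipticCurves.DeShalit1987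
  Literature.NumberTheory.EllipticCurves.Hida2010MuInvariant Literature.NumberTheory.EllipticCurves.BCGKPST2020
open Literature.NumberTheory.IwasawaTheory Literature.NumberTheory.IwasawaTheory.Greenberg2016
  Literature.NumberTheory.IwasawaTheory.Greenberg2006
open Summit.BirchSwinnertonDyer.Rank1Residual.X1.KellerYinHalves
  Summit.BirchSwinnertonDyer.Rank1Residual.X2.ResidualDevissageModules
  Summit.BirchSwinnertonDyer.Rank1Residual.X1.KellerYinMuLambdaSplitDSFree
  Summit.BirchSwinnertonDyer.BirchSwinnertonDyer.Theorems
  Summit.BirchSwinnertonDyer.BirchSwinnertonDyer.Theorems.GoodLatticeBDPValueHalves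
  Summit.BirchSwinnertonDyer.BirchSwinnertonDyer.Theorems.GoodLatticeBDPValueOfImprimitive
  Summit.BirchSwinnertonDyer.BirchSwinnertonDyer.Theorems.GoodLatticeBDPValueOfOneInequality
  Summit.BirchSwinnertonDyer.BirchSwinnertonDyer.Theorems.GoodLatticeImprimitiveOfQuotient
  Summit.BirchSwinnertonDyer.BirchSwinnertonDyer.Theorems.GoodLatticeQuotientOfCorank
  Summit.BirchSwinnertonDyer.BirchSwinnertonDyer.Theorems.GoodLatticeCorankOfGe

namespace Summit.BirchSwinnertonDyer.BirchSwinnertonDyer.Theorems.GoodLatticeBDPValueOfNamedFactsSix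

/-! ## §1 [AN]-DS-Free in the ℚ-currency from KY Thm. 2.2.2 (all odd `p`), de Shalit II.6.4 and CGLS Thm. 2.1.2 -/

/-- **[AN]-DS-Free IN THE ℚ-CURRENCY from three named inputs** — LEAD g5's `GoodLatticeBDPValueOfNamedFacts.anQ_of_pieces` with
explicit inputs: [AN] in the CGLS currency at every odd `p` (`han : thm222_anacong_goodLattice_OPEN`, read at the restricted pair via
`isResidualPairOver_restrictField`) instantiated at the CGLS frame of AN-F₁ (`GoodLatticeBDPValueAnQStubs.stub_katzLineIntFrameQ`,
input de Shalit II.6.4 `hII64`) and descended to `R₀` by AN-F₂ (`KatzLineDescent.stub_katzLineDescentQ`, input CGLS Thm. 2.1.2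
`h212`) at `m = ord(g(S = 0) mod p)`; `n_φ` is replaced by that index by uniqueness of the first unit coefficient.
[cite: KellerYin2024, Thms. 2.2.1–2.2.2] [cite: CastellaGrossiLeeSkinner2022, Thm. 2.1.2, Thm. 2.2.2 with (2.13)–(2.16)] [cite: deShalit1987, II.6.4] -/
theorem anQ_of_thm222_OPEN (hII64 : thmII64_katzMeasure₂_functionalEquation)
    (han : thm222_anacong_goodLattice_OPEN) (h212 : thm212_exists_isKatzLFunction) :
    ∀ (W : WeierstrassCurve ℚ) [W.IsElliptic] [W.IsGloballyMinimal] (p : ℕ) [Fact p.Prime],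
      2 < p → Good W p → Red W p → Anom W p →
      (∀ Φ : AddSubgroup (geomTorsion W (p : ℤ)), IsRationalLine W p Φ → ¬ LineUnramifiedAt W p Φ) →
      ∀ (K : Type) [Field K] [NumberField K], IsImaginaryQuadratic K →
        SatisfiesHeegnerHypothesis (W.conductorNorm ℤ) K → SatisfiesHeegnerHypothesis p K →
        Odd (NumberField.discr K) → NumberField.discr K ≠ -3 →
        (∀ Q : (W.baseChange K).toAffine.Point, p • Q = 0 → Q = 0) →
      ∀ (ι : K →+* ℚ_[p]) (v vbar : HeightOneSpectrum (𝓞 K)),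
        (∀ x : 𝓞 K, x ∈ v.asIdeal ↔ ‖ι (x : K)‖ < 1) →
        ((p : ℕ) : 𝓞 K) ∈ vbar.asIdeal → vbar ≠ v →
      ∀ (κ : ZpExtension K p), κ.IsAnticyclotomic →
      ∀ (γ : absoluteGaloisGroup K) [Fact (κ.IsTopGenerator γ)],
      ∀ (N : ℕ) [NeZero N] (Dt : ModularParametrizationData W N),
      ∀ (ι' : PadicAlgCl p ≃+* ℂ),
        (∀ (w : InfinitePlace K) (k : 𝓞 K), k ∈ v.asIdeal ↔ ‖ι'.symm (w.embedding (k : K))‖ < 1) →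
      ∀ (ΩK : ℂ) (Ωp : (unrIntegers p)ˣ) (L : UnrSeries p), ΩK ≠ 0 →
        IsBDPLFunction ι' v κ γ Dt.f ΩK ((Ωp : unrIntegers p) : ℂ_[p]) L →
      ∀ (Φ : AddSubgroup (geomTorsion W (p : ℤ))), IsRationalLine W p Φ →
      ∀ (θsub θquot : FramedGaloisRep ℚ (padicCoeffIntegers (∅ : Set (PadicAlgCl p))) 1),
        IsTeichmullerLiftOn (∅ : Set (PadicAlgCl p)) (Φ.map (geomTorsion W (p : ℤ)).subtype) θsub →
        IsTeichmullerLiftOnQuot (∅ : Set (PadicAlgCl p)) (Φ.map (geomTorsion W (p : ℤ)).subtype)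
          (geomTorsion W (p : ℤ)) θquot →
      ∀ (Sf : Finset (HeightOneSpectrum (𝓞 K))),
        (∀ w : HeightOneSpectrum (𝓞 K), w ∈ Sf ↔ ((W.conductorNorm ℤ : ℤ) : 𝓞 K) ∈ w.asIdeal) →
      ∀ (θK : HeckeCharacter K), IsHeckeCharOf ι' (θquot.restrictField K) θK →
      ∀ (S : Finset (HeightOneSpectrum (𝓞 K))),
        (∀ w : HeightOneSpectrum (𝓞 K), w ∈ S ↔ ¬ θK.IsUnramifiedAt w) →
      ∀ (κ' : ZpExtension K p) (γ' : absoluteGaloisGroup K), ZpExtension.IsTopGeneratorPair κ κ' γ γ' →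
      ∀ (Ω δ : ℂ) (Ωp' : (unrIntegers p)ˣ) (G : PowerSeries (PowerSeries (PadicComplexInt p)))
        (g : IwasawaAlgebra₂ p), Ω ≠ 0 →
        (δ ^ 2 = (NumberField.discr K : ℂ) ∨ δ ^ 2 = -(NumberField.discr K : ℂ)) →
        IsKatzMeasure₂ ι' v vbar S κ κ' γ⁻¹ γ'⁻¹ θK⁻¹ Ω δ ((Ωp' : unrIntegers p) : ℂ_[p]) G →
        (∀ (J : ℤ_[p] →+* PadicComplexInt p),
          (∀ x : ℤ_[p], ((J x : PadicComplexInt p) : ℂ_[p]) = ((x : ℚ_[p]) : ℂ_[p])) →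
          Associated (PowerSeries.map (PowerSeries.map J) g) G) →
        (g.map (PowerSeries.constantCoeff (R := ℤ_[p]))).map (IsLocalRing.residue ℤ_[p]) ≠ 0 →
      ∃ n : ℕ, FirstUnitCoeffAt L n ∧
        n + ∑ w ∈ Sf, curveLocalLambda κ (W.baseChange K) w =
          2 * ((g.map (PowerSeries.constantCoeff (R := ℤ_[p]))).map
                (IsLocalRing.residue ℤ_[p])).order.toNat +
            ∑ w ∈ Sf, (charLocalLambda ∅ κ (θsub.restrictField K) w +
              charLocalLambda ∅ κ (θquot.restrictField K) w) := by
  intro W _ _ p _ hp hgood hred hanom hGL K _ _ hK hHN hHp hodd hd3 hEK ι v vbar hv hvbar hne κ hκ γ _ N _ Dt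
    ι' hι' ΩK Ωp L hΩK hL Φ hΦ θsub θquot hsub hquot Sf hSf θK hθK S hS κ' γ' hpair' Ω δ Ωp' G g hΩ hδ hG
    hJ hg0
  have hpairK := isResidualPairOver_restrictField W p K hΦ hsub hquot
  obtain ⟨ΩK', Ωp'', Q, hΩK', hΩp'', hQ, hm⟩ := GoodLatticeBDPValueAnQStubs.stub_katzLineIntFrameQ hII64 W p hp hgood
    hred hanom hGL K
    hK hHN hHp hodd hd3 ι v vbar hv hvbar hne κ hκ γ ι' hι' Φ hΦ θsub θquot hsub hquot θK hθK S hS κ' γ'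
    hpair' Ω δ Ωp' G g hΩ hδ hG hJ hg0
  obtain ⟨ΩK'', Ωp''', Lφ, hΩK'', hLφ, hdict⟩ := KatzLineDescent.stub_katzLineDescentQ h212 W p hp hgood hred
    hanom hGL K
    hK hHN hHp hodd hd3 ι v vbar hv hvbar hne κ hκ γ ι' hι' Φ hΦ θsub θquot hsub hquot θK hθK _
    ⟨ΩK', Ωp'', Q, hΩK', hΩp'', hQ, hm⟩
  obtain ⟨n, nφ, hn, hnφ, hid⟩ := han W p hp hgood hred hanom hGL K hK hHN hHp hodd hd3 hEK ι v vbar hv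
    hvbar hne κ hκ γ N Dt ι' hι' ΩK Ωp L hΩK hL (θsub.restrictField K) (θquot.restrictField K) hpairK Sf
    hSf θK hθK ∅ (by simp) ΩK'' Ωp''' Lφ hΩK'' hLφ
  obtain rfl := hnφ.unique hdict
  exact ⟨n, hn, hid⟩

/-! ## §2 The composition with stub 1 cut to six -/

/-- **Composition, stub 1 cut to six**: the crux `GoodLatticeBDPValue` BY NAME from ⟨stub 1′: Carayol, CGLS proof-4.2.2, CGLS 5.1.3,
Bleher et al. 3.3.1, de Shalit II.6.4 (i), Hida Thm. I⟩, 3a-A, stub 4, stub 4b and CD2 (the last four = the registered statements of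
halves v22 byte for byte) — LEAD g5's `goodLatticeBDPValue_of_namedFacts` with the terminal consumer replaced by
`GoodLatticeBDPValueH1OfCGLS.goodLatticeBDPValue_of_pub_of_leTD_of_le_of_anQ_of_cgls` (no Castella–Hsieh hypothesis) and [AN] by
§1 on `thm222_OPEN_of_slices … (anThreeTrivial_of_split 3a-A)`; [ALG-imp-λ] glue (`GoodLatticeBDPValueOfNamedFactsALG.imprimLambdaLE_of_index`),
the `prop125` chain and the landed `FSideCorankLe.stub_fSideCorankLe` exactly as there. CONDITIONAL; closes nothing by itself.
[cite: KellerYin2024, Thm. 3.0.8 (IMC2)] [cite: CastellaGrossiLeeSkinner2022, proof of Thm. 4.2.2, Thm. 5.1.3] -/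
theorem goodLatticeBDPValue_of_namedFacts₆
    (stub_publishedFacts₆ :
      (∀ (N : ℕ) [NeZero N], IsNewformOf.level_eq_conductorNorm (N := N)) ∧
      proofThm422_exists_isBDPLFunction_isTorsion_charIdeal_dvd ∧
      thm513_exists_isBDPLFunction_valueAtOne ∧
      thm331_rubin_exists_katzMeasure₂_pseudoIso_span_eq ∧
      thmII64_katzMeasure₂_functionalEquation ∧
      thmI_mu_katzBranch_reflect_eq_zero)
  (stub_anacongOfFullDescentDatum :
  ∀ (W : WeierstrassCurve ℚ) [W.IsElliptic] [W.IsGloballyMinimal] (p : ℕ) [Fact p.Prime],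
    2 < p → Good W p → Red W p → Anom W p →
    ((∃ (ℓ : ℕ) (hℓ : ℓ.Prime), haveI : Fact ℓ.Prime := ⟨hℓ⟩; Addv W ℓ) ∨
      (∃ (ℓ : ℕ) (hℓ : ℓ.Prime), haveI : Fact ℓ.Prime := ⟨hℓ⟩;
        W.HasMultiplicativeReductionAtPrime ℓ ∧
          ((W.HasSplitMultiplicativeReductionAtPrime ℓ ∧ ℓ ≡ 1 [MOD p]) ∨
            (¬ W.HasSplitMultiplicativeReductionAtPrime ℓ ∧ ℓ + 1 ≡ 0 [MOD p])))) →
    (∀ Φ : AddSubgroup (geomTorsion W (p : ℤ)), IsRationalLine W p Φ → ¬ LineUnramifiedAt W p Φ) →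
    ∀ (K : Type) [Field K] [NumberField K], IsImaginaryQuadratic K →
      SatisfiesHeegnerHypothesis (W.conductorNorm ℤ) K → SatisfiesHeegnerHypothesis p K →
      Odd (NumberField.discr K) → NumberField.discr K ≠ -3 →
      (∀ Q : (W.baseChange K).toAffine.Point, p • Q = 0 → Q = 0) →
    ∀ (ι : K →+* ℚ_[p]) (v vbar : HeightOneSpectrum (𝓞 K)),
      (∀ x : 𝓞 K, x ∈ v.asIdeal ↔ ‖ι (x : K)‖ < 1) →
      ((p : ℕ) : 𝓞 K) ∈ vbar.asIdeal → vbar ≠ v →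
    ∀ (κ : ZpExtension K p), κ.IsAnticyclotomic →
    ∀ (γ : absoluteGaloisGroup K) [Fact (κ.IsTopGenerator γ)],
    ∀ (N : ℕ) [NeZero N] (Dt : ModularParametrizationData W N),
    ∀ (ι' : PadicAlgCl p ≃+* ℂ),
      (∀ (w : InfinitePlace K) (k : 𝓞 K), k ∈ v.asIdeal ↔ ‖ι'.symm (w.embedding (k : K))‖ < 1) →
    ∀ (ΩK : ℂ) (Ωp : (unrIntegers p)ˣ) (L : UnrSeries p), ΩK ≠ 0 →
      IsBDPLFunction ι' v κ γ Dt.f ΩK ((Ωp : unrIntegers p) : ℂ_[p]) L →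
    ∀ (θsub θquot : FramedGaloisRep K (padicCoeffIntegers (∅ : Set (PadicAlgCl p))) 1),
      IsResidualPairOver (W.baseChange K) p θsub θquot →
    ∀ (Sf : Finset (HeightOneSpectrum (𝓞 K))),
      (∀ w : HeightOneSpectrum (𝓞 K), w ∈ Sf ↔ ((W.conductorNorm ℤ : ℤ) : 𝓞 K) ∈ w.asIdeal) →
    ∀ (θK : HeckeCharacter K), IsHeckeCharOf ι' θquot θK →
    ∀ (Cbar : Finset (HeightOneSpectrum (𝓞 K))), (∀ u ∈ Cbar, ¬ θK.IsUnramifiedAt u) →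
    ∀ (ΩK' : ℂ) (Ωp' : (unrIntegers p)ˣ) (Lφ : UnrSeries p), ΩK' ≠ 0 →
      IsKatzLFunction ι' v vbar Cbar κ γ θK ΩK' ((Ωp' : unrIntegers p) : ℂ_[p]) Lφ →
    ∃ n nφ : ℕ, FirstUnitCoeffAt L n ∧ FirstUnitCoeffAt Lφ nφ ∧
      n + ∑ w ∈ Sf, curveLocalLambda κ (W.baseChange K) w =
        2 * nφ + ∑ w ∈ Sf, (charLocalLambda ∅ κ θsub w + charLocalLambda ∅ κ θquot w))
  (stub_publishedFactsGreenberg :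
    prop411_selmer_isAlmostDivisible ∧ prop422_localCohomology_isAlmostDivisible ∧
      sec5A_localH2_subsingleton_of_LOC1 ∧ prop41_globalEulerPoincareCorank ∧
      prop42_localEulerPoincareCorank ∧ prop32_cohomology_isCofinitelyGenerated ∧
      BCGKPST2020.sec33_rubin_unrSelmer₂_finite_torsion ∧
      weakLeopoldt_H2_subsingleton_above_cyclotomic_of_isOpen)
  (stub_publishedFactsMore :
    prop263_sur_of_crk ∧ thm222_anacong_goodLattice_of_five_le ∧ thm222_anacong_goodLattice_of_ne_one ∧
      thm212_exists_isKatzLFunction)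
  (stub_publishedFactCD2 :
    ∀ (L : Type) [Field L] [NumberField L],
      Literature.NumberTheory.GaloisCohomology.groupCdLE_two_galoisGroupUnramifiedOutside L) :
    Summit.BirchSwinnertonDyer.BirchSwinnertonDyer.Theses.EisensteinPrimes.GoodLatticeBDPValue :=
  GoodLatticeBDPValueH1OfCGLS.goodLatticeBDPValue_of_pub_of_leTD_of_le_of_anQ_of_cgls
    stub_publishedFacts₆.1 stub_publishedFacts₆.2.1 stub_publishedFacts₆.2.2.1 stub_publishedFacts₆.2.2.2.1
    stub_publishedFacts₆.2.2.2.2.1 stub_publishedFacts₆.2.2.2.2.2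
    stub_publishedFactsGreenberg.1 stub_publishedFactsGreenberg.2.1 stub_publishedFactsGreenberg.2.2.1
    stub_publishedFactsGreenberg.2.2.2.1 stub_publishedFactsGreenberg.2.2.2.2.1
    stub_publishedFactsGreenberg.2.2.2.2.2.1 stub_publishedFactsGreenberg.2.2.2.2.2.2.1
    stub_publishedFactsGreenberg.2.2.2.2.2.2.2
    (GoodLatticeBDPValueOfNamedFactsALG.imprimLambdaLE_of_index stub_publishedFactsGreenberg stub_publishedFactsMore
      stub_publishedFactCD2)
    (prop125_imprimitive_of_quotient
      (prop125_quotient_of_corank (prop125_corank_of_ge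
        (AcTwistDeformation.prop125_residualPair_unrSelmer_corank_ge_of_facts stub_publishedFactsMore.1
          stub_publishedFactsGreenberg.2.2.2.1 stub_publishedFactsGreenberg.2.2.2.2.1
          stub_publishedFactsGreenberg.2.2.1 stub_publishedFactsGreenberg.2.2.2.2.2.1))))
    FSideCorankLe.stub_fSideCorankLe
    (anQ_of_thm222_OPEN stub_publishedFacts₆.2.2.2.2.1
      (GoodLatticeBDPValueOfNamedFacts.thm222_OPEN_of_slices stub_publishedFactsMore.2.1 stub_publishedFactsMore.2.2.1
        (GoodLatticeBDPValueOfNamedFacts.anThreeTrivial_of_split stub_anacongOfFullDescentDatum))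
      stub_publishedFactsMore.2.2.2)

end Summit.BirchSwinnertonDyer.BirchSwinnertonDyer.Theorems.GoodLatticeBDPValueOfNamedFactsSix
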